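import Summits.BirchSwinnertonDyer.BirchSwinnertonDyer.Theorems.UniversalToricDescentDefectTransportTwinTower
import HarnessLib

/-!
# Route UniversalToricDescent — stub B′ RANK-FREE MODULO THREE TOWER STATEMENTS ABOUT THE TWIN, quantified only over
# the subsets of the bad set (the form the registered twin stubs of line `sigmacongruence` v3 deliver)

Lead prover bsd-wall-utd-p1 g14 (`--supports` ♭T′ stmt-BirchSwinnertonDyer-26975; line `sigmacongruence`, stub B′). Same statement and
proof as `defectTransport_algebraicHalf_lambda_of_wall_of_twinTower` (file `…DefectTransportTwinTower`), but the three twin tower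
hypotheses (S′) `hsig'`, (Σ′) `hsigS'`, (N′) `hnf'` are asked ONLY for imprimitivity sets `S ⊆ Σ_bad = {v ∤ 3 : E_K or E′_K bad at v}`
(finite, finitely decomposed in `K_∞` under the Heegner hypotheses) — exactly where the proof uses them and exactly what the
registered stubs `stub_twinStrictSurj` / `stub_twinSigmaSurj` / `stub_twinNoFinite` of the skeleton conclude (their Poitou–Tate
arguments need a FINITE relaxed set). §1 `defectTransport_algebraicHalf_lambda_of_wall_of_twinTowerOnBadSet`.
HONEST STATUS: helper theorem, CONDITIONAL on the cited Poitou–Tate facts and on the three twin tower statements (hypotheses);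
stub B′, B″ 27121 and ♭T′ remain OPEN. THEOREMS ONLY; no definition, no named fact, no `sorry`. BSD is not advanced by this file.
References: [GreenbergVatsal2000] Thm. (1.4), §2 (2.1), (2.3)–(2.5), (2.8), (2.10); [GreenbergLNM1716] §4 pp. 122–126; [Brink2007] Cor. 1.
-/

set_option autoImplicit false
-- `…BirchSwinnertonDyer.BirchSwinnertonDyer.Theorems…` is the problem's mandated namespace (D-0017).
set_option linter.dupNamespace false

noncomputable section
open scoped Classical

namespace Summit.BirchSwinnertonDyer.BirchSwinnertonDyer.Theorems.UniversalToricDescentDefectTransport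

open Function Field NumberField IsDedekindDomain WeierstrassCurve
open Literature.NumberTheory.GaloisRepresentations Literature.NumberTheory.EllipticCurves
  Literature.NumberTheory.EllipticCurves.GreenbergSelmer Literature.NumberTheory.GaloisCohomology
  Literature.NumberTheory.EllipticCurves.IwasawaAlgebra Literature.NumberTheory.EllipticCurves.Rank1Residual
  Summit.BirchSwinnertonDyer.Rank1Residual Summit.BirchSwinnertonDyer.Rank1Residual.X11b
  Summit.BirchSwinnertonDyer.Rank1Residual.X11b.Coinv Summit.BirchSwinnertonDyer.Rank1Residual.X11b.AcSelmer
  Summit.BirchSwinnertonDyer.Rank1Residual.X11b.LocBridge Summit.BirchSwinnertonDyer.Rank1Residual.Iwasawa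
  Summit.BirchSwinnertonDyer.BirchSwinnertonDyer.Theorems.UniversalToricDescentSigmaPassage
  Summit.BirchSwinnertonDyer.BirchSwinnertonDyer.Theorems.UniversalToricDescentSigmaLocalImage
  Summit.BirchSwinnertonDyer.BirchSwinnertonDyer.Theorems.UniversalToricDescentSigmaLocalStabilizer
  Summit.BirchSwinnertonDyer.BirchSwinnertonDyer.Theorems.UniversalToricDescentSigmaCoinvariants
  Summit.BirchSwinnertonDyer.BirchSwinnertonDyer.Theorems.UniversalToricDescentAcDualMuZero
  Summit.BirchSwinnertonDyer.BirchSwinnertonDyer.Theorems.UniversalToricDescentTorsionMuTransportHeegner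
  Summit.BirchSwinnertonDyer.BirchSwinnertonDyer.Theorems.UniversalToricDescentStrictPlaceTuple
  Summit.BirchSwinnertonDyer.BirchSwinnertonDyer.Theorems.UniversalToricDescentResidualSelmer
  Summit.BirchSwinnertonDyer.BirchSwinnertonDyer.Theorems.SchneiderFreeAdditiveX3
  Summit.BirchSwinnertonDyer.BirchSwinnertonDyer.Theorems.SchneiderFreeControlAtoms
  Summit.BirchSwinnertonDyer.BirchSwinnertonDyer.Theorems.PotentiallySupersingularLocalTorsion

/-! ### §1 Stub B′ from the wall + the three tower statements about the twin on the subsets of the bad set -/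

/-- **Stub B′'s conclusion VERBATIM from B′'s binders + (S′) + (Σ′) + (N′) asked only on `S ⊆ Σ_bad`** (`hsig'` at
`S = Σ_bad`; `hsigS'` at `S ⊆ Σ_bad`, `v ∈ Σ_bad ∖ S`; `hnf'` at `S ⊆ Σ_bad`). Proof VERBATIM
`defectTransport_algebraicHalf_lambda_of_wall_of_twinTower`. [cite: GreenbergVatsal2000, Thm. (1.4), §2 Prop. (2.1), Cor. (2.3), (2.5), (2.10)]
[cite: GreenbergLNM1716, §4 Prop. 4.13–4.15 (pp. 122–126)] [cite: Serre1967GroupesPDivisibles, §5 Prop. 8] [cite: Brink2007, Cor. 1] -/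
theorem defectTransport_algebraicHalf_lambda_of_wall_of_twinTowerOnBadSet (W W' : WeierstrassCurve ℚ)
    [W.IsElliptic] [W.IsGloballyMinimal] [W'.IsElliptic] [W'.IsGloballyMinimal] {N N' : ℕ} (K : Type) [Field K]
    [NumberField K]
    (hO6 : Additive.ClassO6 W 3) (hsurj : W.HasSurjectiveModNGaloisRep 3) (hN : W.conductorNorm ℤ = N)
    (hcong : O6.ModPCongruent W' W 3) (hadd' : ¬ Addv W' 3) (hN' : W'.conductorNorm ℤ = N')
    (hK : IsImaginaryQuadratic K)
    (hHe : SatisfiesHeegnerHypothesis N K) (hHe' : SatisfiesHeegnerHypothesis N' K)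
    (κ : ZpExtension K 3) (hκ : κ.IsAnticyclotomic) (γ : absoluteGaloisGroup K)
    [Fact (κ.IsTopGenerator γ)] {𝔭' : HeightOneSpectrum (𝓞 K)} (h𝔭' : ((3 : ℕ) : 𝓞 K) ∈ 𝔭'.asIdeal)
    (hT : Module.IsTorsion (IwasawaAlgebra 3) (XAc (W.baseChange K) 3 κ 𝔭' ∅ γ))
    {L : UnrSeries 3}
    (hle : Ideal.span {L} ≤
      (XAc.charIdeal (W.baseChange K) 3 κ 𝔭' ∅ γ).map (PowerSeries.map (Halves.toUnr 3)))
    (hi : ∃ i : ℕ, ‖((PowerSeries.coeff i L : unrIntegers 3) : ℂ_[3])‖ = 1)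
    (hPT : poitouTate_selmerStructure_duality K) (hPT2 : poitouTate_sha_tateDual K)
    (hfin : ∀ v : HeightOneSpectrum (𝓞 K), ((3 : ℕ) : 𝓞 K) ∈ v.asIdeal →
      Finite (selmerAcBase (W.baseChange K) 3 v ∅))
    (hsig' : ∀ (S : Set (HeightOneSpectrum (𝓞 K))), S = {v : HeightOneSpectrum (𝓞 K) | ((3 : ℕ) : 𝓞 K) ∉ v.asIdeal ∧
        (¬ (W.baseChange K).HasGoodReductionAt v ∨ ¬ (W'.baseChange K).HasGoodReductionAt v)} →
      ∀ (v₀ : HeightOneSpectrum (𝓞 K)), ((3 : ℕ) : 𝓞 K) ∉ v₀.asIdeal →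
      v₀ ∉ S → ∀ (F : absoluteGaloisGroup K → subgroupH1 (kerD κ 𝔭') ((W'.baseChange K).geomPrimaryTorsion 3)),
      (∀ (σ h : absoluteGaloisGroup K), h ∈ κ.kerSubgroup → F (σ * h) = F σ) →
      (∀ (d : decomp (K := K) 𝔭') (σ : absoluteGaloisGroup K), F ((d : absoluteGaloisGroup K) * σ) =
        conjH1 (kerD κ 𝔭') ((W'.baseChange K).geomPrimaryTorsion 3) d (F σ)) →
      ∃ s ∈ selmerAc (W'.baseChange K) 3 κ v₀ S, ∀ σ : absoluteGaloisGroup K,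
        resKerD κ ((W'.baseChange K).geomPrimaryTorsion 3) 𝔭' ((W'.baseChange K).conjH1 3 κ.kerSubgroup σ s) = F σ)
    (hsigS' : ∀ (S : Set (HeightOneSpectrum (𝓞 K))), S ⊆ {v : HeightOneSpectrum (𝓞 K) | ((3 : ℕ) : 𝓞 K) ∉ v.asIdeal ∧
        (¬ (W.baseChange K).HasGoodReductionAt v ∨ ¬ (W'.baseChange K).HasGoodReductionAt v)} →
      ∀ (v : HeightOneSpectrum (𝓞 K)), ((3 : ℕ) : 𝓞 K) ∉ v.asIdeal →
      (¬ (W.baseChange K).HasGoodReductionAt v ∨ ¬ (W'.baseChange K).HasGoodReductionAt v) →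
      v ∉ S → ¬ (decomp v ≤ κ.kerSubgroup) →
      ∀ (F : absoluteGaloisGroup K → subgroupH1 (kerD κ v) ((W'.baseChange K).geomPrimaryTorsion 3)),
      (∀ (σ h : absoluteGaloisGroup K), h ∈ κ.kerSubgroup → F (σ * h) = F σ) →
      (∀ (d : decomp (K := K) v) (σ : absoluteGaloisGroup K), F ((d : absoluteGaloisGroup K) * σ) =
        conjH1 (kerD κ v) ((W'.baseChange K).geomPrimaryTorsion 3) d (F σ)) →
      ∃ s ∈ selmerAc (W'.baseChange K) 3 κ 𝔭' (insert v S), ∀ σ : absoluteGaloisGroup K,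
        resKerD κ ((W'.baseChange K).geomPrimaryTorsion 3) v ((W'.baseChange K).conjH1 3 κ.kerSubgroup σ s) = F σ)
    (hnf' : ∀ (S : Set (HeightOneSpectrum (𝓞 K))), S ⊆ {v : HeightOneSpectrum (𝓞 K) | ((3 : ℕ) : 𝓞 K) ∉ v.asIdeal ∧
        (¬ (W.baseChange K).HasGoodReductionAt v ∨ ¬ (W'.baseChange K).HasGoodReductionAt v)} →
      ∀ (M : Submodule (IwasawaAlgebra 3) (XAc (W'.baseChange K) 3 κ 𝔭' S γ)), Finite M → M = ⊥) :
    ∃ (T : Finset (HeightOneSpectrum (𝓞 K))) (c s s' : HeightOneSpectrum (𝓞 K) → ℕ),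
      (↑T = {v : HeightOneSpectrum (𝓞 K) | ((3 : ℕ) : 𝓞 K) ∉ v.asIdeal ∧
        (¬ (W.baseChange K).HasGoodReductionAt v ∨ ¬ (W'.baseChange K).HasGoodReductionAt v)}) ∧
      (∀ v ∈ T, (∃ d₀ : decomp (K := K) v, (κ (d₀ : absoluteGaloisGroup K)).toAdd = (3 : ℤ_[3]) ^ c v) ∧
        (∀ d : decomp (K := K) v, (3 : ℤ_[3]) ^ c v ∣ (κ (d : absoluteGaloisGroup K)).toAdd) ∧
        Nat.card {f : subgroupH1 (kerD κ v) ((W.baseChange K).geomPrimaryTorsion 3) // 3 • f = 0} =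
          3 ^ s v ∧
        Nat.card {f : subgroupH1 (kerD κ v) ((W'.baseChange K).geomPrimaryTorsion 3) // 3 • f = 0} =
          3 ^ s' v) ∧
      (∃ g : UnrSeries 3,
        (XAc.charIdeal (W.baseChange K) 3 κ 𝔭' ∅ γ).map (PowerSeries.map (Halves.toUnr 3)) =
            Ideal.span {g} ∧
          (∀ i < lambdaInvariant 3 (XAc (W.baseChange K) 3 κ 𝔭' ∅ γ),
            ‖((PowerSeries.coeff i g : unrIntegers 3) : ℂ_[3])‖ < 1) ∧
          ‖((PowerSeries.coeff (lambdaInvariant 3 (XAc (W.baseChange K) 3 κ 𝔭' ∅ γ)) g :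
            unrIntegers 3) : ℂ_[3])‖ = 1) ∧
      Module.IsTorsion (IwasawaAlgebra 3) (XAc (W'.baseChange K) 3 κ 𝔭' ∅ γ) ∧
      (∃ g' : UnrSeries 3,
        (XAc.charIdeal (W'.baseChange K) 3 κ 𝔭' ∅ γ).map (PowerSeries.map (Halves.toUnr 3)) =
            Ideal.span {g'} ∧
          (∀ i < lambdaInvariant 3 (XAc (W'.baseChange K) 3 κ 𝔭' ∅ γ),
            ‖((PowerSeries.coeff i g' : unrIntegers 3) : ℂ_[3])‖ < 1) ∧
          ‖((PowerSeries.coeff (lambdaInvariant 3 (XAc (W'.baseChange K) 3 κ 𝔭' ∅ γ)) g' :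
            unrIntegers 3) : ℂ_[3])‖ = 1) ∧
      lambdaInvariant 3 (XAc (W.baseChange K) 3 κ 𝔭' ∅ γ) + ∑ v ∈ T, 3 ^ c v * s v =
        lambdaInvariant 3 (XAc (W'.baseChange K) 3 κ 𝔭' ∅ γ) + ∑ v ∈ T, 3 ^ c v * s' v  := by
  haveI : Fact (Nat.Prime 3) := ⟨Nat.prime_three⟩
  -- the bad set `Σ`
  set S : Set (HeightOneSpectrum (𝓞 K)) := {v | ((3 : ℕ) : 𝓞 K) ∉ v.asIdeal ∧
    (¬ (W.baseChange K).HasGoodReductionAt v ∨ ¬ (W'.baseChange K).HasGoodReductionAt v)} with hSdef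
  have hSfin : S.Finite := by
    refine (((W.baseChange K).finite_badPlaces_holds (𝓞 K)).union
      ((W'.baseChange K).finite_badPlaces_holds (𝓞 K))).subset fun v hv ↦ ?_
    rcases hv.2 with h | h
    · exact Or.inl h
    · exact Or.inr h
  have hSp : ∀ v ∈ S, ((3 : ℕ) : 𝓞 K) ∉ v.asIdeal := fun v hv ↦ hv.1
  have hSdec : ∀ v ∈ S, ¬ (decomp v ≤ κ.kerSubgroup) := by
    intro v hv
    rcases hv.2 with h | h
    · exact not_decomp_le_kerSubgroup_of_not_hasGoodReductionAt_baseChange W hN K hK hHe (by decide) κ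
        hκ hv.1 h
    · exact not_decomp_le_kerSubgroup_of_not_hasGoodReductionAt_baseChange W' hN' K hK hHe' (by decide)
        κ hκ hv.1 h
  have hgood : ∀ v : HeightOneSpectrum (𝓞 K), v ∉ S → ((3 : ℕ) : 𝓞 K) ∉ v.asIdeal →
      (W.baseChange K).HasGoodReductionAt v := fun v hv hpv ↦ by
    by_contra h; exact hv ⟨hpv, Or.inl h⟩
  have hgood' : ∀ v : HeightOneSpectrum (𝓞 K), v ∉ S → ((3 : ℕ) : 𝓞 K) ∉ v.asIdeal →
      (W'.baseChange K).HasGoodReductionAt v := fun v hv hpv ↦ by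
    by_contra h; exact hv ⟨hpv, Or.inr h⟩
  -- `3` splits in the Heegner field
  have hadd : Addv W 3 := hO6.2.1
  have hpN : 3 ∣ W.conductorNorm ℤ := (W.dvd_conductorNorm_iff_not_hasGoodReductionAtPrime 3).mpr hadd.1
  have hsplit : SplitsIn K 3 := hHe 3 (Fact.out) (hN ▸ hpN)
  -- `Sel^Σ(E)[3]` is finite: `μ(X_E) = 0` from the wall
  haveI := XAc.module_finite κ 𝔭' (∅ : Set (HeightOneSpectrum (𝓞 K))) γ Set.finite_empty (W := W.baseChange K)
  have hμe : muInvariant 3 (XAc (W.baseChange K) 3 κ 𝔭' ∅ γ) = 0 :=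
    muInvariant_eq_zero_of_span_le_map_charIdeal (XAc (W.baseChange K) 3 κ 𝔭' ∅ γ) hT hle hi
  have hfine : Set.Finite {s : selmerAc (W.baseChange K) 3 κ 𝔭' ∅ | 3 • s = 0} :=
    finite_pTorsion_of_muInvariant_eq_zero (W.baseChange K) 3 κ 𝔭' ∅ γ hT hμe
  have hfinS : Set.Finite {s : selmerAc (W.baseChange K) 3 κ 𝔭' S | 3 • s = 0} :=
    finite_selmerAc_pTorsion_of_empty (W.baseChange K) κ hSfin hSp hSdec hfine
  -- the wild curve's local tower torsion at `𝔭′` is finite (Serre 1967 Prop. 8 on the O6 class)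
  have hδ : LocalTowerTorsionFiniteAt (W.baseChange K) 3 κ 𝔭' :=
    localTowerTorsionFiniteClaim_three_of_classO6 Serre1967.noStableDivisibleLine_of_potentiallySupersingular_holds W
      hO6 K hK hsplit κ hκ 𝔭' h𝔭'
  -- the twin's local tower torsion at `𝔭′` is finite (by reduction type)
  have hδ' : LocalTowerTorsionFiniteAt (W'.baseChange K) 3 κ 𝔭' :=
    localTowerTorsionFiniteAt_baseChange_three_of_not_addv W' hadd' hK hsplit κ hκ 𝔭' h𝔭'
  -- (S′) in tuple form at `𝔭′` (for the data chosen inside (M1))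
  have hsurj' : ∀ (v₀ : HeightOneSpectrum (𝓞 K)), ((3 : ℕ) : 𝓞 K) ∉ v₀.asIdeal → v₀ ∉ S → ∀ (c : ℕ),
      (∀ z : ℤ_[3], ∃ d : decomp (K := K) 𝔭', (κ (d : absoluteGaloisGroup K)).toAdd = (3 : ℤ_[3]) ^ c * z) →
      (∀ d : decomp (K := K) 𝔭', (3 : ℤ_[3]) ^ c ∣ (κ (d : absoluteGaloisGroup K)).toAdd) →
      ∀ g : Fin (3 ^ c) → subgroupH1 (kerD κ 𝔭') ((W'.baseChange K).geomPrimaryTorsion 3),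
        ∃ s ∈ selmerAc (W'.baseChange K) 3 κ v₀ S, ∀ i : Fin (3 ^ c),
          resKerD κ ((W'.baseChange K).geomPrimaryTorsion 3) 𝔭'
            ((W'.baseChange K).conjH1 3 κ.kerSubgroup (γ ^ (i : ℕ)) s) = g i := by
    intro v₀ hv₀ hv₀S c hc hle g
    exact exists_mem_forall_fin_of_forall_sig (W'.baseChange K) 3 κ (Fact.out : κ.IsTopGenerator γ) 𝔭' hc hle
      (selmerAc (W'.baseChange K) 3 κ v₀ S) (hsig' S hSdef v₀ hv₀ hv₀S) g
  -- (M1) with the twin's tower inputs, then the Σ-product of the twin, then the FRAME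
  have hcmp := natCard_selmerAc_pTorsion_baseChange_eq_of_modPCongruent_of_twinTower W W' 3 (by decide) hK hsplit hPT hPT2
    κ hκ (γ := γ) Fact.out h𝔭' (by exact_mod_cast hsurj) hcong hSfin hgood hgood' hfin hsurj'
    (fun hfinS' ↦ selmerAc_divisible_of_finite_pTorsion_of_noFinite (W'.baseChange K) 3 κ 𝔭' γ hSfin hfinS'
      (hnf' S subset_rfl))
    hfinS hδ hδ'
  have hprodTwin : ∀ (hS : Set.Finite S) (c : HeightOneSpectrum (𝓞 K) → ℕ),
      (∀ v ∈ S, ∀ z : ℤ_[3], ∃ d : decomp (K := K) v, (κ (d : absoluteGaloisGroup K)).toAdd = (3 : ℤ_[3]) ^ c v * z) →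
      (∀ v ∈ S, ∀ d : decomp (K := K) v, (3 : ℤ_[3]) ^ c v ∣ (κ (d : absoluteGaloisGroup K)).toAdd) →
      Set.Finite {s : selmerAc (W'.baseChange K) 3 κ 𝔭' S | 3 • s = 0} →
      Nat.card {b : selmerAc (W'.baseChange K) 3 κ 𝔭' S ⧸
          (selmerAc (W'.baseChange K) 3 κ 𝔭' ∅).addSubgroupOf (selmerAc (W'.baseChange K) 3 κ 𝔭' S) // 3 • b = 0} =
        ∏ v ∈ hS.toFinset, Nat.card {f : subgroupH1 (kerD κ v) ((W'.baseChange K).geomPrimaryTorsion 3) //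
          3 • f = 0} ^ (3 ^ c v) := by
    intro hS c hc hle hfinS'
    have hT : S = ∅ ∪ ↑hS.toFinset := by rw [Set.empty_union, Set.Finite.coe_toFinset]
    have key := natCard_quotient_pTorsion_eq_prod_of_surj (W'.baseChange K) 3 κ (𝔭 := 𝔭') (Fact.out : κ.IsTopGenerator γ) ∅ c hS.toFinset
      (fun v hv ↦ hSp v ((Set.Finite.mem_toFinset hS).mp hv)) (fun v _ ↦ Set.notMem_empty v)
      (fun v hv ↦ hc v ((Set.Finite.mem_toFinset hS).mp hv))
      (fun v hv S' _ hS'S hvS' f ↦ by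
        have hv' := (Set.Finite.mem_toFinset hS).mp hv
        have hS'sub : S' ⊆ S := fun w hw ↦ by
          rcases hS'S hw with h | h
          · exact (Set.notMem_empty w h).elim
          · exact (Set.Finite.mem_toFinset hS).mp h
        exact exists_mem_forall_fin_of_forall_sig (W'.baseChange K) 3 κ (Fact.out : κ.IsTopGenerator γ) v (hc v hv')
          (hle v hv') (selmerAc (W'.baseChange K) 3 κ 𝔭' (insert v S'))
          (hsigS' S' hS'sub v (hSp v hv') hv'.2 hvS' (hSdec v hv')) f)
      (fun T' hT' ↦ by
        have hsub : (∅ : Set (HeightOneSpectrum (𝓞 K))) ∪ ↑T' ⊆ S := by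
          rw [Set.empty_union]; exact fun v hv ↦ (Set.Finite.mem_toFinset hS).mp (hT' hv)
        exact selmerAc_divisible_of_finite_pTorsion_of_noFinite (W'.baseChange K) 3 κ 𝔭' γ
          (hS.subset hsub) (finite_selmerAc_pTorsion_of_subset (W'.baseChange K) 3 κ hsub hfinS') (hnf' _ hsub))
    rw [← hT] at key
    exact key
  exact defectTransport_algebraicHalf_lambda_of_wall_of_residual W W' K hO6 hN hN' hK hHe hHe' κ hκ γ h𝔭' hT hle hi hPT
    hPT2 hfin hcmp (hnf' ∅ (Set.empty_subset _)) hprodTwin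

end Summit.BirchSwinnertonDyer.BirchSwinnertonDyer.Theorems.UniversalToricDescentDefectTransport

end
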